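import Summits.NavierStokesRegularity.NavierStokesRegularity.Theorems.SqueezeCycleRecurrentLiouvilleNearIdentityDSS
import Summits.NavierStokesRegularity.NavierStokesRegularity.Theorems.RecurrentProfilesRecurrentReductionOrbit
import Literature.Analysis.FluidPDE.LocalTypeICongr
import HarnessLib

/-!
# Crux `RecurrentLiouville` (stmt-NavierStokesRegularity-1589), line `Sketch` (v7) — stub S3:
  the Chae rung in the Albritton–Barker class (no scale-invariant cluster point of the scaling orbit)

`stub_frNoInvariantClusterPoint`: let `(u, p)` be a suitable weak solution of Navier–Stokes
(`ν = 1`, `f = 0`) on the backward slab `ℝ³ × ℝ₋ = (-∞, 0) × ℝ³` with weak gradient `G`,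
Albritton–Barker quantity `𝐈(ℝ³ × ℝ₋) < ∞` and the Type-I rate `‖u(t, x)‖ ≤ C/√(−t)`.  If some
sequence of points `u_{c_n}` (`c_n > 0`) of its scaling orbit (`u_c(t, x) = c u(c² t, c x)`)
converges in `L³(Q(0, R))`, for every `R > 0`, to a measurable field `w` which is almost everywhere
SCALE INVARIANT on the slab (`e^σ w(e^{2σ} t, e^σ x) = w(t, x)` for a.e. `(t, x)`, every `σ`), then
`u` is regular at the space–time origin.  Equivalently: the `α`/`ω`-limit sets (indeed all cluster
points) of the scaling orbit of a Type-I singularity model in the Albritton–Barker class contain no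
self-similar field — D. Chae's exclusion of asymptotically self-similar blow-up (Math. Ann. 338
(2007), Thm 1.5) in the decay-free suitable weak class.

Proof.  Suppose the origin is backward singular.  By `exists_orbit_limit` (A–B Lemma 2.2 +
Prop. 2.3 on the orbit, every point of which is singular) a subsequence `u_{c_{ψ j}}` converges in
every `L³(Q(0, R))` to a singular slab profile `u'` with `𝐈 ≤ 4 𝐈(u)` and the rate a.e.; by
uniqueness of `L³_loc` limits (`ae_eq_lowerHalf_of_tendsto_eLpNorm`) `u' = w` a.e. on the slab;
by `exists_rate_profile_repr` `u'` has an a.e.-equal representative `w''` in the pointwise rate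
class, still singular; transporting `w'' = w` a.e. along the parabolic dilations
(`rlNearIdentityDSS_ae_comp_dilation`) makes `w''` a.e. scale invariant; so by
`stub_rlSelfSimilarRepr` it is a.e. a pointwise scale-invariant Type-I ancient mild field, which
vanishes by `stub_rlSelfSimilarMildVanishes` (Tsai 1998, Thm 1, `q = ∞`, KNSS gauge); hence
`w'' = 0` a.e. on `Q(0, 1)`, contradicting `‖w''‖_{L^∞(Q(0,1))} = ∞`.

## References

* D. Chae, Math. Ann. 338 (2007) 435–449 = arXiv:math/0604234, Thm 1.5. [Chae2007]
* T.-P. Tsai, Arch. Rational Mech. Anal. 143 (1998), Thm 1. [Tsai1998]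
* D. Albritton, T. Barker, J. Math. Fluid Mech. 21 (2019) = arXiv:1811.00502, Lemma 2.2, Prop. 2.3.
  [AlbrittonBarker2019]
-/

noncomputable section

-- the sub-problem namespace repeats the summit name (D-0017 layout `Summit.<S>.<P>.Theorems`)
set_option linter.dupNamespace false

namespace Summit.NavierStokesRegularity.NavierStokesRegularity.Theorems

open MeasureTheory Set Function Filter Topology TopologicalSpace Metric
open Literature.Analysis Literature.Analysis.FluidPDE
open scoped NNReal ENNReal

/-! ## Two pieces of a.e. bookkeeping on the slab -/

/-- **A.e. scale invariance passes to a.e.-equal fields.**  If `w'' = w` a.e. on the backward slab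
and `w` is a.e. scale invariant there (`w_{e^σ} = w` a.e., every `σ`), then so is `w''`: the a.e.
identity is transported along the non-singular, slab-preserving parabolic dilation
`(t, x) ↦ (e^{2σ} t, e^σ x)`. [folklore] -/
theorem frNoInvariantClusterPoint_ae_scaleInvariant_congr
    {w w'' : ℝ → EuclideanSpace ℝ (Fin 3) → EuclideanSpace ℝ (Fin 3)}
    (hE : ∀ᵐ z ∂(volume.restrict (Iio (0 : ℝ) ×ˢ (univ : Set (EuclideanSpace ℝ (Fin 3))))),
      uncurry w'' z = uncurry w z)
    (hinv : ∀ σ : ℝ, ∀ᵐ z ∂(volume.restrict (Iio (0 : ℝ) ×ˢ (univ : Set (EuclideanSpace ℝ (Fin 3))))),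
      nsRescale (Real.exp σ) w z.1 z.2 = w z.1 z.2) (σ : ℝ) :
    ∀ᵐ z ∂(volume.restrict (Iio (0 : ℝ) ×ˢ (univ : Set (EuclideanSpace ℝ (Fin 3))))),
      nsRescale (Real.exp σ) w'' z.1 z.2 = w'' z.1 z.2 := by
  have ht := rlNearIdentityDSS_ae_comp_dilation (F := uncurry w'') (G := uncurry w) (Real.exp_pos σ) hE
  filter_upwards [ht, hinv σ, hE] with z h1 h2 h3
  rw [uncurry_apply_pair, uncurry_apply_pair] at h1
  have h3' : w'' z.1 z.2 = w z.1 z.2 := h3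
  rw [nsRescale_apply, h1, ← nsRescale_apply, h2, h3']

/-- **A field vanishing a.e. on the slab is not backward singular at the origin**: it vanishes a.e.
on `Q(0, 1) ⊆ ℝ³ × ℝ₋`, so `‖w‖_{L^∞(Q(0,1))} = 0 ≠ ∞`. [folklore] -/
theorem frNoInvariantClusterPoint_not_singular_of_ae_zero
    {w : ℝ → EuclideanSpace ℝ (Fin 3) → EuclideanSpace ℝ (Fin 3)}
    (hw0 : ∀ᵐ z ∂(volume.restrict (Iio (0 : ℝ) ×ˢ (univ : Set (EuclideanSpace ℝ (Fin 3))))),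
      uncurry w z = (0 : ℝ × EuclideanSpace ℝ (Fin 3) → EuclideanSpace ℝ (Fin 3)) z) :
    ¬ IsBackwardSingularPoint w 0 := by
  intro hsing
  have hQ : ∀ᵐ z ∂(volume.restrict (parabolicCylinder 1 (0 : ℝ × EuclideanSpace ℝ (Fin 3)))),
      uncurry w z = (0 : ℝ × EuclideanSpace ℝ (Fin 3) → EuclideanSpace ℝ (Fin 3)) z :=
    ae_restrict_of_ae_restrict_of_subset (parabolicCylinder_origin_subset_slab 1) hw0
  have h0 : eLpNorm (uncurry w) ∞
      (volume.restrict (parabolicCylinder 1 (0 : ℝ × EuclideanSpace ℝ (Fin 3)))) = 0 := by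
    rw [eLpNorm_congr_ae hQ, eLpNorm_zero]
  have htop := hsing 1 one_pos
  rw [h0] at htop
  exact ENNReal.zero_ne_top htop

/-! ## Stub S3 — the Chae rung: no scale-invariant cluster point of the orbit -/

/-- **S3 — the Chae rung in the Albritton–Barker class.**  A suitable weak solution `(u,p)` on
`ℝ³ × ℝ₋` with weak gradient `G`, `𝐈 < ⊤` and the rate `C`, some sequence of whose scaling-orbit
points `u_{c_n}` (`c_n > 0`) converges in `L³(Q(0,R))`, for every `R > 0`, to a (measurable)
field `w` that is a.e. scale invariant on the slab, is regular at the origin: otherwise the limit is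
(a.e.) a singular class profile (`exists_orbit_limit`, persistence; uniqueness of `L³_loc` limits),
a.e. equal to a pointwise scale-invariant Type-I ancient mild field (`exists_rate_profile_repr`,
`stub_rlSelfSimilarRepr`), which vanishes (`stub_rlSelfSimilarMildVanishes`, Tsai 1998 Thm 1) —
absurd.  Chae 2007 Thm 1.5 (no asymptotically self-similar blow-up) in the decay-free suitable weak
class. [cite: Chae2007, Thm 1.5; Tsai1998, Thm 1; AlbrittonBarker2019, Prop. 2.3] -/
theorem stub_frNoInvariantClusterPoint :
    ∀ (C : ℝ) (u : ℝ → EuclideanSpace ℝ (Fin 3) → EuclideanSpace ℝ (Fin 3))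
      (p : ℝ → EuclideanSpace ℝ (Fin 3) → ℝ)
      (G : ℝ → EuclideanSpace ℝ (Fin 3) → EuclideanSpace ℝ (Fin 3) →L[ℝ] EuclideanSpace ℝ (Fin 3)),
      IsSuitableWeakSolutionOn (slab (EuclideanSpace ℝ (Fin 3)) (Iio 0) isOpen_Iio) 1 0 u p →
      HasWeakSpatialGradientOn (slab (EuclideanSpace ℝ (Fin 3)) (Iio 0) isOpen_Iio) u G →
      typeIBound (Iio (0 : ℝ) ×ˢ univ) u p G < ⊤ →
      HasTypeITimeDecay C u →
      ∀ (c : ℕ → ℝ), (∀ n, 0 < c n) →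
      ∀ (w : ℝ → EuclideanSpace ℝ (Fin 3) → EuclideanSpace ℝ (Fin 3)),
        (∀ R : ℝ, 0 < R → AEStronglyMeasurable (uncurry w)
          (volume.restrict (parabolicCylinder R (0 : ℝ × EuclideanSpace ℝ (Fin 3))))) →
        (∀ R : ℝ, 0 < R → Tendsto (fun n => eLpNorm (uncurry (nsRescale (c n) u) - uncurry w) 3
          (volume.restrict (parabolicCylinder R (0 : ℝ × EuclideanSpace ℝ (Fin 3))))) atTop (𝓝 0)) →
        (∀ σ : ℝ, ∀ᵐ z ∂(volume.restrict (Iio (0 : ℝ) ×ˢ (univ : Set (EuclideanSpace ℝ (Fin 3))))),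
          nsRescale (Real.exp σ) w z.1 z.2 = w z.1 z.2) →
        ¬ IsBackwardSingularPoint u 0 := by
  intro C u p G hsw hwg hI hdec c hc w hwm hconv hinv hsing
  -- `0 ≤ C`, from the rate of `u` at `(t, x) = (-1, 0)`
  have hC0 : 0 ≤ C := by
    have h := hdec (-1) (by norm_num) 0
    have h1 : (0 : ℝ) ≤ C / Real.sqrt (-(-1 : ℝ)) := (norm_nonneg _).trans h
    rw [neg_neg, Real.sqrt_one, div_one] at h1
    exact h1
  -- Step 1: a subsequence of the orbit converges to a singular slab profile `u'` with the rate a.e.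
  obtain ⟨u', p', H', ψ, hψ, hsw', hwg', hI', hsing', hrate', hconv'⟩ :=
    exists_orbit_limit hsw hwg hI hsing hdec c hc
  have hI't : typeIBound (Iio (0 : ℝ) ×ˢ univ) u' p' H' < ⊤ :=
    lt_of_le_of_lt hI' (ENNReal.mul_lt_top (by simp) hI)
  -- Step 2: uniqueness of `L³_loc` limits — `u' = w` a.e. on the slab
  have hvm : ∀ (n : ℕ) (j : ℕ), AEStronglyMeasurable (uncurry (nsRescale (c (ψ j)) u))
      (volume.restrict (parabolicCylinder ((n : ℝ) + 1) (0 : ℝ × EuclideanSpace ℝ (Fin 3)))) := by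
    intro n j
    rw [nsRescale_eq_zoom]
    exact (zoom_slabProfile hsw hwg (hc _)).2.1.locallyIntegrableOn.aestronglyMeasurable.mono_measure
      (Measure.restrict_mono (parabolicCylinder_origin_subset_slab _) le_rfl)
  have hwm1 : ∀ n : ℕ, AEStronglyMeasurable (uncurry u')
      (volume.restrict (parabolicCylinder ((n : ℝ) + 1) (0 : ℝ × EuclideanSpace ℝ (Fin 3)))) :=
    fun n => hwg'.locallyIntegrableOn.aestronglyMeasurable.mono_measure
      (Measure.restrict_mono (parabolicCylinder_origin_subset_slab _) le_rfl)
  have hwm2 : ∀ n : ℕ, AEStronglyMeasurable (uncurry w)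
      (volume.restrict (parabolicCylinder ((n : ℝ) + 1) (0 : ℝ × EuclideanSpace ℝ (Fin 3)))) :=
    fun n => hwm _ (by positivity)
  have hE2 : ∀ᵐ z ∂(volume.restrict (Iio (0 : ℝ) ×ˢ (univ : Set (EuclideanSpace ℝ (Fin 3))))),
      uncurry u' z = uncurry w z :=
    ae_eq_lowerHalf_of_tendsto_eLpNorm (v := fun j => nsRescale (c (ψ j)) u) (w := u') (w' := w)
      hvm hwm1 hwm2 (fun n => hconv' _ (by positivity))
      (fun n => (hconv _ (by positivity)).comp hψ.tendsto_atTop)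
  -- Step 3: a representative `w''` of `u'` in the pointwise rate class, still singular
  obtain ⟨w'', hae'', hsw'', hwg'', hI'', hdec'', hsing''⟩ :=
    exists_rate_profile_repr hC0 hsw' hwg' hI't hsing' hrate'
  -- Step 4: `w'' = w` a.e., hence `w''` is a.e. scale invariant on the slab
  have hE : ∀ᵐ z ∂(volume.restrict (Iio (0 : ℝ) ×ˢ (univ : Set (EuclideanSpace ℝ (Fin 3))))),
      uncurry w'' z = uncurry w z := by
    filter_upwards [hae'', hE2] with z h1 h2
    rw [← h1, h2]
  have hinv'' : ∀ σ : ℝ, ∀ᵐ z ∂(volume.restrict (Iio (0 : ℝ) ×ˢ (univ : Set (EuclideanSpace ℝ (Fin 3))))),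
      nsRescale (Real.exp σ) w'' z.1 z.2 = w'' z.1 z.2 :=
    frNoInvariantClusterPoint_ae_scaleInvariant_congr hE hinv
  -- Step 5: continuous, pointwise scale-invariant Type-I ancient mild representative; it vanishes
  obtain ⟨v, hv, hvss, haev⟩ := stub_rlSelfSimilarRepr C w'' p' H' hsw'' hwg'' hI'' hdec'' hinv''
  have hv0 : ∀ t : ℝ, t < 0 → ∀ x, v t x = 0 := stub_rlSelfSimilarMildVanishes C v hv hvss
  -- Step 6: hence `w'' = 0` a.e. on the slab: not singular — contradiction
  have hw0 : ∀ᵐ z ∂(volume.restrict (Iio (0 : ℝ) ×ˢ (univ : Set (EuclideanSpace ℝ (Fin 3))))),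
      uncurry w'' z = (0 : ℝ × EuclideanSpace ℝ (Fin 3) → EuclideanSpace ℝ (Fin 3)) z := by
    filter_upwards [haev, ae_restrict_mem (measurableSet_Iio.prod MeasurableSet.univ)] with z hz hzm
    rw [hz, Pi.zero_apply]
    exact hv0 z.1 hzm.1 z.2
  exact frNoInvariantClusterPoint_not_singular_of_ae_zero hw0 hsing''

end Summit.NavierStokesRegularity.NavierStokesRegularity.Theorems

end
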